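import Literature.AnabelianGeometry.EtaleTheta.Discharge.Sec5Lem59vTransport

/-!
# [EtTh] Lemma 5.9 (v): the §2-side slot `ρ219` PINNED through the bi-theta isomorphism of Lemma 5.9 (iv)

Mochizuki, *The étale theta function and its Frobenioid-theoretic manifestations*, Publ. RIMS **45** (2009),
Lemma 5.9 (v), p.332 (PDF p.106) [cite: MochizukiEtTh2009, Lem 5.9 (v) p.332 (PDF p.106)]: "In the situation of
(iv), the cyclotomic rigidity isomorphism arising from the theory of §2 [cf. Corollary 2.19, (i)] coincides with
the Frobenioid-theoretic isomorphism of Proposition 5.5 [where we take '`S`' to be `B_N`]."  abc-iut cell, layer L2,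
MERGE-PLAN row 10 of abc-iut-L2-t4 («pin the parameter `ρ219` of `CycRigidityCoincide`»), written by abc-iut-w4-d042
(gen 2) on abc-iut-L2-lead's GO (2026-08-26T02:51:16Z; first refusal of L2-t4/L2-t11 lapsed).  ADDITIVE: nothing of
L2-t4's `FrobenioidMonoThetaEnv.lean` / `FrobenioidCyclotomicRigidity.lean` or L2-t11's `Sec5BiThetaIso.lean` is edited;
their `CycRigidityCoincide ρ219 ρ hB` keeps its parameter — this file supplies a NAMED VALUE for it.

"The cyclotomic rigidity isomorphism arising from the theory of §2", transported to
`(l·Δ_Θ)_{B_N} ⊗ ℤ/Nℤ ⥲ μ_N(B_N)` in the situation of (iv), has two legs: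

* the `μ`-leg **`muEquivOfBiTheta`** `: μ_N(B_N) ⥲ μ_N` — CANONICAL, DEFINED here from the bi-theta isomorphism
  `i : E^Π_N ⥲ Π^tp_Y[μ_N]` of Lemma 5.9 (iv) alone: `i` carries `Ker(E^Π_N ↠ Π^tp_Y̲) = μ_N(B_N)` (L2-t4's `toPiY_ker`)
  ONTO `Ker(Π^tp_Y[μ_N] ↠ Π^tp_Y) = μ_N` because it lies over `Π^tp_Y̲` (`hi`); characterised by
  `inMu_muEquivOfBiTheta : μ(m u) = i(u, 1)` (so the last conjunct of L2-t4's `EnvIsoBiTheta`, "carrying `μ_N(B_N)`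
  into `μ_N`", is automatic: `biThetaIso_muIncl_mem_range_inMu`);
* the `Δ`-leg `ψ : (l·Δ_Θ)_{B_N} ⊗ ℤ/Nℤ ⥲ μ_N` — the §2 identification `θ-mod : l·Δ_Θ ↠ (l·Δ_Θ) ⊗ ℤ/Nℤ ⥲ μ_N`
  (Cor. 2.19 (i), L2-t2's `RigidData.thetaMod`, `= η` on `l·Δ_Θ` by `cocycle_lDeltaTheta`) read on the §5 subquotient
  `(l·Δ_Θ)_{B_N}` of `Aut_D(B_N^bs)`.  The §5 subquotient is L2-t4's ABSTRACT `ThetaSubquotientStub` / `ThetaSubquotientProj`,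
  so this leg is a BINDER with its defining law `IsDeltaLeg` (on the class of `proj(ρ y)` it is `η(ι y)`, for
  `y ∈ Π^tp_Ÿ̲` over `l·Δ_Θ`) — the one reading that remains until the §5 data are built over L2-t9's concrete
  `thetaSubquotientStub` (MERGE-PLAN §2 «§5 GENUINE DATA»); nothing is asserted about it.

Then **`rho219OfBiTheta ψ := ψ ≫ (muEquivOfBiTheta)⁻¹`** is the pinned slot, and
**`cycRigidityCoincide_rho219OfBiTheta`**: Prop. 5.5 BY NAME (`IsKummerDetermined`) + the `Δ`-leg law + coverage of
`(l·Δ_Θ)_{B_N} ⊗ ℤ/Nℤ` by classes `[proj(ρ y)]` ⟹ L2-t4's `CycRigidityCoincide (rho219OfBiTheta …) ρ hB` — Lemma 5.9 (v)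
in L2-t4's typed form with the §2 side no longer a free parameter (via this seat's pointwise
`biThetaIso_muIncl_rigidity`, p417589).  `EnvIsoBiTheta`-packaged: `cycRigidityCoincide_rho219_of_envIsoBiTheta`.
HONEST FRAMING: [EtTh] is refereed; kernel-checked constructions/implications between its typed statements; the
`Δ`-leg is a named binder, not a fact; nothing here bears on [IUTchIII] Cor. 3.12; no side taken; typed ≠ proved.
-/

noncomputable section

namespace Literature.AnabelianGeometry.EtaleTheta

open CategoryTheory
open FrobenioidCyclotomicRigidity

universe w v v' u u'

namespace ThetaFrobenioid

variable {C : Type u} [Category.{v} C] {D : Type u'} [Category.{v'} D] (𝔉 : ThetaFrobenioid.{w} C D)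
  (h1 : 𝔉.SectionsFactor) (h3 : 𝔉.OuterActionLZ) (hsec : 𝔉.SgpCapSection) (hcs : 𝔉.SgpCupSection)
  (h8 : 𝔉.ConstantsEqNormalizer) (DK : Set (TopOut 𝔉.EPiN))
  {N : ℕ+} (T : ThetaEnvData.{v} N) (ι : 𝔉.PiX ≃ₜ* T.PiX)

/-! ## The `Δ`-leg law (a predicate on a binder) -/

/-- The DEFINING LAW of the `Δ`-leg `ψ : (l·Δ_Θ)_{B_N} ⊗ ℤ/Nℤ ⥲ μ_N` ("the §2 identification `θ-mod = η` on `l·Δ_Θ`,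
read on the §5 subquotient of `Aut_D(B_N^bs)`"): on the class of `proj(ρ y)` — `y ∈ Π^tp_Ÿ̲` with `ι y` over `Δ` and
`ρ y` in the theta pre-subgroup of L2-t4's `ThetaSubquotientProj` — `ψ` is `η(ι y)`.  A PREDICATE on the binder
`ψ` (parameters only; nothing asserted): the shape the §2 ↔ §5 identification of `(l·Δ_Θ)` must have.
[cite: MochizukiEtTh2009, Cor 2.19 (i) p.290 (PDF p.64); §5 p.327 (PDF p.101)] -/
def IsDeltaLeg (η : T.PiYdd → T.mu) (hYdd : 𝔉.PiYdd.map ι.toMonoidHom = T.PiYdd) (P : ThetaSubquotientProj 𝔉)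
    (ψ : 𝔉.lDeltaModN 𝔉.BN ≃* T.mu) : Prop :=
  ∀ (y : 𝔉.PiYdd) (_ : T.aug (ι (y : 𝔉.PiX)) = 1)
    (hh : ((𝔉.rhoYdd y : 𝔉.HB) : Aut (𝔉.base.obj 𝔉.BN)) ∈ P.pre (𝔉.base.obj 𝔉.BN)),
    ψ (QuotientGroup.mk (P.proj _ ⟨_, hh⟩)) = η ⟨ι (y : 𝔉.PiX), 𝔉.iota_mem_PiYdd T ι hYdd y⟩

variable {η : T.PiYdd → T.mu} (hη : η ∈ T.thetaCocycles)
  (i : (𝔉.frdBiThetaEnv h1 h3 hsec hcs h8 DK).Iso (T.modelBi hη))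

/-! ## The `μ`-leg: `μ_N(B_N) ⥲ μ_N` from the bi-theta isomorphism -/

/-- The bi-theta isomorphism on a product of elements of `E^Π_N` (bookkeeping: `E^Π_N` and the underlying group of
`frdBiThetaEnv` are the same group). [cite: MochizukiEtTh2009, Lem 5.9 (iv) p.332 (PDF p.106)] -/
theorem biThetaIso_map_mul (a b : 𝔉.EPiN) : i.e (a * b) = i.e a * i.e b :=
  map_mul i.e (a : (𝔉.frdBiThetaEnv h1 h3 hsec hcs h8 DK).Pi) (b : (𝔉.frdBiThetaEnv h1 h3 hsec hcs h8 DK).Pi)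

/-- Under a bi-theta isomorphism lying over `Π^tp_Y̲`, the image of `(u, 1)` (`u ∈ μ_N(B_N)`) lies in the cyclotome
`μ_N ⊆ Π^tp_Y[μ_N]` — the last conjunct of L2-t4's `EnvIsoBiTheta` DERIVED from the fourth.
[cite: MochizukiEtTh2009, Lem 5.9 (iv) p.332 (PDF p.106)] -/
theorem biThetaIso_muIncl_mem_range_inMu
    (hi : ∀ x : 𝔉.EPiN, ((CycEnvelope.proj T.augY T.chi (i.e x) : T.PiY) : T.PiX) = ι (𝔉.toPiY x))
    (u : 𝔉.muTorsion 𝔉.BN 𝔉.N) : i.e (𝔉.muIncl u) ∈ (CycEnvelope.inMu T.augY T.chi).range := by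
  rw [← CycEnvelope.ker_proj_eq_range_inMu, MonoidHom.mem_ker, ← Subtype.coe_inj, OneMemClass.coe_one, hi]
  change ι (𝔉.toPiY (𝔉.muIncl u)) = 1
  rw [show 𝔉.toPiY (𝔉.muIncl u) = 1 from rfl, map_one]

/-- Conversely the preimage of `μ(a)` under the bi-theta isomorphism lies in `Ker(E^Π_N ↠ Π^tp_Y̲) = μ_N(B_N)`.
[cite: MochizukiEtTh2009, Lem 5.9 (iv) p.332 (PDF p.106)] -/
theorem biThetaIso_symm_inMu_mem_range_muIncl
    (hi : ∀ x : 𝔉.EPiN, ((CycEnvelope.proj T.augY T.chi (i.e x) : T.PiY) : T.PiX) = ι (𝔉.toPiY x))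
    (a : T.mu) : i.e.symm (CycEnvelope.inMu T.augY T.chi a) ∈ 𝔉.muIncl.range := by
  rw [← 𝔉.toPiY_ker hsec]
  refine (MonoidHom.mem_ker (f := 𝔉.toPiY)).mpr ?_
  apply ι.injective
  rw [map_one, ← hi, ContinuousMulEquiv.apply_symm_apply]
  rfl

/-- **The `μ`-leg `μ_N(B_N) ⥲ μ_N` of the §2 ↔ §5 cyclotome dictionary, CANONICAL from the bi-theta isomorphism of
Lemma 5.9 (iv)**: `u ↦ μ⁻¹(i(u, 1))`, with inverse `a ↦ (i⁻¹(μ a))` read in `μ_N(B_N)`.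
[cite: MochizukiEtTh2009, Lem 5.9 (iv)/(v) p.332 (PDF p.106)] -/
def muEquivOfBiTheta
    (hi : ∀ x : 𝔉.EPiN, ((CycEnvelope.proj T.augY T.chi (i.e x) : T.PiY) : T.PiX) = ι (𝔉.toPiY x)) :
    𝔉.muTorsion 𝔉.BN 𝔉.N ≃* T.mu where
  toFun u := (𝔉.biThetaIso_muIncl_mem_range_inMu h1 h3 hsec hcs h8 DK T ι hη i hi u).choose
  invFun a := (𝔉.biThetaIso_symm_inMu_mem_range_muIncl h1 h3 hsec hcs h8 DK T ι hη i hi a).choose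
  left_inv u := by
    -- `μ_N(B_N) ↪ E^Π_N` is injective (first component); stated in the tree as
    -- `Literature.IUT.HodgeArakelov.muIncl_injective` (layer L6, not importable here)
    have hinj : Function.Injective 𝔉.muIncl := fun u v h => Subtype.ext (by
      simpa only [ThetaFrobenioid.coe_muIncl] using congrArg (fun y : 𝔉.EPiN => ((y : Aut 𝔉.BN × 𝔉.PiX)).1) h)
    apply hinj
    rw [(𝔉.biThetaIso_symm_inMu_mem_range_muIncl h1 h3 hsec hcs h8 DK T ι hη i hi _).choose_spec,
      (𝔉.biThetaIso_muIncl_mem_range_inMu h1 h3 hsec hcs h8 DK T ι hη i hi u).choose_spec,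
      ContinuousMulEquiv.symm_apply_apply]
  right_inv a := by
    have hinj : Function.Injective (CycEnvelope.inMu T.augY T.chi) := SemidirectProduct.inl_injective
    apply hinj
    rw [(𝔉.biThetaIso_muIncl_mem_range_inMu h1 h3 hsec hcs h8 DK T ι hη i hi _).choose_spec,
      (𝔉.biThetaIso_symm_inMu_mem_range_muIncl h1 h3 hsec hcs h8 DK T ι hη i hi a).choose_spec,
      ContinuousMulEquiv.apply_symm_apply]
  map_mul' u v := by
    have hinj : Function.Injective (CycEnvelope.inMu T.augY T.chi) := SemidirectProduct.inl_injective
    apply hinj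
    have huv := (𝔉.biThetaIso_muIncl_mem_range_inMu h1 h3 hsec hcs h8 DK T ι hη i hi (u * v)).choose_spec
    have hu := (𝔉.biThetaIso_muIncl_mem_range_inMu h1 h3 hsec hcs h8 DK T ι hη i hi u).choose_spec
    have hv := (𝔉.biThetaIso_muIncl_mem_range_inMu h1 h3 hsec hcs h8 DK T ι hη i hi v).choose_spec
    calc CycEnvelope.inMu T.augY T.chi
          (𝔉.biThetaIso_muIncl_mem_range_inMu h1 h3 hsec hcs h8 DK T ι hη i hi (u * v)).choose
        = i.e (𝔉.muIncl (u * v)) := huv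
      _ = i.e (𝔉.muIncl u * 𝔉.muIncl v) := by rw [map_mul 𝔉.muIncl]
      _ = i.e (𝔉.muIncl u) * i.e (𝔉.muIncl v) := 𝔉.biThetaIso_map_mul h1 h3 hsec hcs h8 DK T hη i _ _
      _ = CycEnvelope.inMu T.augY T.chi
            ((𝔉.biThetaIso_muIncl_mem_range_inMu h1 h3 hsec hcs h8 DK T ι hη i hi u).choose *
             (𝔉.biThetaIso_muIncl_mem_range_inMu h1 h3 hsec hcs h8 DK T ι hη i hi v).choose) := by
          rw [map_mul, hu, hv]

/-- The `μ`-leg is characterised by `μ(m u) = i(u, 1)`. [cite: MochizukiEtTh2009, Lem 5.9 (iv) p.332 (PDF p.106)] -/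
theorem inMu_muEquivOfBiTheta
    (hi : ∀ x : 𝔉.EPiN, ((CycEnvelope.proj T.augY T.chi (i.e x) : T.PiY) : T.PiX) = ι (𝔉.toPiY x))
    (u : 𝔉.muTorsion 𝔉.BN 𝔉.N) :
    CycEnvelope.inMu T.augY T.chi (𝔉.muEquivOfBiTheta h1 h3 hsec hcs h8 DK T ι hη i hi u) = i.e (𝔉.muIncl u) :=
  (𝔉.biThetaIso_muIncl_mem_range_inMu h1 h3 hsec hcs h8 DK T ι hη i hi u).choose_spec

/-- … equivalently `i(m⁻¹ a, 1) = μ(a)`. [cite: MochizukiEtTh2009, Lem 5.9 (iv) p.332 (PDF p.106)] -/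
theorem biThetaIso_muIncl_muEquivOfBiTheta_symm
    (hi : ∀ x : 𝔉.EPiN, ((CycEnvelope.proj T.augY T.chi (i.e x) : T.PiY) : T.PiX) = ι (𝔉.toPiY x))
    (a : T.mu) :
    i.e (𝔉.muIncl ((𝔉.muEquivOfBiTheta h1 h3 hsec hcs h8 DK T ι hη i hi).symm a)) = CycEnvelope.inMu T.augY T.chi a := by
  rw [← 𝔉.inMu_muEquivOfBiTheta h1 h3 hsec hcs h8 DK T ι hη i hi, MulEquiv.apply_symm_apply]

/-! ## The pinned slot `ρ219` -/

/-- **The PINNED §2-side slot `ρ219` of Lemma 5.9 (v)** ("the cyclotomic rigidity isomorphism arising from the theory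
of §2 [cf. Corollary 2.19, (i)]", as an isomorphism `(l·Δ_Θ)_{B_N} ⊗ ℤ/Nℤ ⥲ μ_N(B_N)` in the situation of (iv)):
`Δ`-leg followed by the inverse of the canonical `μ`-leg. [cite: MochizukiEtTh2009, Lem 5.9 (v) p.332 (PDF p.106)] -/
def rho219OfBiTheta
    (hi : ∀ x : 𝔉.EPiN, ((CycEnvelope.proj T.augY T.chi (i.e x) : T.PiY) : T.PiX) = ι (𝔉.toPiY x))
    (ψ : 𝔉.lDeltaModN 𝔉.BN ≃* T.mu) : 𝔉.lDeltaModN 𝔉.BN ≃* 𝔉.muTorsion 𝔉.BN 𝔉.N :=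
  ψ.trans (𝔉.muEquivOfBiTheta h1 h3 hsec hcs h8 DK T ι hη i hi).symm

/-- The pinned slot transported back by `i`: `i(ρ219(x), 1) = μ(ψ x)`. [cite: MochizukiEtTh2009, Lem 5.9 (v) p.332 (PDF p.106)] -/
theorem biThetaIso_muIncl_rho219OfBiTheta
    (hi : ∀ x : 𝔉.EPiN, ((CycEnvelope.proj T.augY T.chi (i.e x) : T.PiY) : T.PiX) = ι (𝔉.toPiY x))
    (ψ : 𝔉.lDeltaModN 𝔉.BN ≃* T.mu) (x : 𝔉.lDeltaModN 𝔉.BN) :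
    i.e (𝔉.muIncl (𝔉.rho219OfBiTheta h1 h3 hsec hcs h8 DK T ι hη i hi ψ x)) = CycEnvelope.inMu T.augY T.chi (ψ x) :=
  𝔉.biThetaIso_muIncl_muEquivOfBiTheta_symm h1 h3 hsec hcs h8 DK T ι hη i hi (ψ x)

/-- **[EtTh] Lemma 5.9 (v) in L2-t4's typed form WITH THE §2 SLOT PINNED**: given Prop. 5.5 BY NAME
(`IsKummerDetermined P ρ hB`), a `Δ`-leg `ψ` satisfying its defining law (`IsDeltaLeg`), and coverage of
`(l·Δ_Θ)_{B_N} ⊗ ℤ/Nℤ` by classes `[proj(ρ y)]` with `y ∈ Π^tp_Ÿ̲` over `Δ`, the Frobenioid-theoretic `ρ_{B_N}` of Prop. 5.5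
EQUALS `rho219OfBiTheta` — `CycRigidityCoincide (rho219OfBiTheta …) ρ hB`.
[cite: MochizukiEtTh2009, Lem 5.9 (v) p.332 (PDF p.106)] -/
theorem cycRigidityCoincide_rho219OfBiTheta
    (hi : ∀ x : 𝔉.EPiN, ((CycEnvelope.proj T.augY T.chi (i.e x) : T.PiY) : T.PiX) = ι (𝔉.toPiY x))
    (hYdd : 𝔉.PiYdd.map ι.toMonoidHom = T.PiYdd) (P : ThetaSubquotientProj 𝔉) (ρ : RigidityFamily 𝔉)
    (hB : 𝔉.IsThetaSaturated 𝔉.BN) (hρ : IsKummerDetermined 𝔉 P ρ hB) (ψ : 𝔉.lDeltaModN 𝔉.BN ≃* T.mu)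
    (hψ : 𝔉.IsDeltaLeg T ι η hYdd P ψ)
    (hcov : ∀ x : 𝔉.lDeltaModN 𝔉.BN, ∃ (y : 𝔉.PiYdd) (_ : T.aug (ι (y : 𝔉.PiX)) = 1)
      (hh : ((𝔉.rhoYdd y : 𝔉.HB) : Aut (𝔉.base.obj 𝔉.BN)) ∈ P.pre (𝔉.base.obj 𝔉.BN)),
      (QuotientGroup.mk (P.proj _ ⟨_, hh⟩) : 𝔉.lDeltaModN 𝔉.BN) = x) :
    𝔉.CycRigidityCoincide (𝔉.rho219OfBiTheta h1 h3 hsec hcs h8 DK T ι hη i hi ψ) ρ hB :=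
  𝔉.cycRigidityCoincide_of_biTheta h1 h3 hsec hcs h8 DK T ι hη i hi hYdd P ρ hB hρ _ hcov fun y hy hh => by
    rw [𝔉.biThetaIso_muIncl_rho219OfBiTheta h1 h3 hsec hcs h8 DK T ι hη i hi ψ, hψ y hy hh]

/-- Over a rigidity interface `R : RigidData` (L2-t2) the `Δ`-leg law reads `ψ[proj(ρ y)] = θ-mod(ι y)` for
`ι y ∈ l·Δ_Θ` (`cocycle_lDeltaTheta`): the §2 cyclotomic rigidity identification of Cor. 2.19 (i) on the nose.
[cite: MochizukiEtTh2009, Cor 2.19 (i) p.290 (PDF p.64)] -/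
theorem isDeltaLeg_apply_eq_thetaMod {l : ℕ} (R : RigidData.{v} N l) (ι : 𝔉.PiX ≃ₜ* R.PiX)
    {η : R.PiYdd → R.mu} (hη : η ∈ R.thetaCocycles)
    (hYdd : 𝔉.PiYdd.map ι.toMonoidHom = R.PiYdd) (P : ThetaSubquotientProj 𝔉)
    (ψ : 𝔉.lDeltaModN 𝔉.BN ≃* R.mu) (hψ : 𝔉.IsDeltaLeg R.toThetaEnvData ι η hYdd P ψ)
    (y : 𝔉.PiYdd) (hy : ι (y : 𝔉.PiX) ∈ R.lDeltaTheta)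
    (hh : ((𝔉.rhoYdd y : 𝔉.HB) : Aut (𝔉.base.obj 𝔉.BN)) ∈ P.pre (𝔉.base.obj 𝔉.BN)) :
    ψ (QuotientGroup.mk (P.proj _ ⟨_, hh⟩)) = R.thetaMod ⟨ι (y : 𝔉.PiX), hy⟩ := by
  rw [hψ y (Subgroup.mem_inf.mp (R.lDeltaTheta_le hy)).2 hh, R.cocycle_lDeltaTheta η hη _ hy]

/-! ## Packaged over L2-t4's `EnvIsoBiTheta` -/

/-- **Lemma 5.9 (v) with pinned §2 slot, from Lemma 5.9 (iv) BY NAME** (`EnvIsoBiTheta`, its isomorphism extracted by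
choice): for the extracted `(η, i)` and every `Δ`-leg `ψ` satisfying its law, `ρ_{B_N} = rho219OfBiTheta ψ`.
[cite: MochizukiEtTh2009, Lem 5.9 (iv)/(v) p.332 (PDF p.106)] -/
theorem cycRigidityCoincide_rho219_of_envIsoBiTheta {T : ThetaEnvData.{v} 𝔉.N} {ι : 𝔉.PiX ≃ₜ* T.PiX}
    (h59iv : 𝔉.EnvIsoBiTheta h1 h3 hsec hcs h8 DK T ι) (P : ThetaSubquotientProj 𝔉) (ρ : RigidityFamily 𝔉)
    (hB : 𝔉.IsThetaSaturated 𝔉.BN) (hρ : IsKummerDetermined 𝔉 P ρ hB)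
    (ψ : 𝔉.lDeltaModN 𝔉.BN ≃* T.mu)
    (hψ : 𝔉.IsDeltaLeg T ι h59iv.2.2.choose h59iv.2.1 P ψ)
    (hcov : ∀ x : 𝔉.lDeltaModN 𝔉.BN, ∃ (y : 𝔉.PiYdd) (_ : T.aug (ι (y : 𝔉.PiX)) = 1)
      (hh : ((𝔉.rhoYdd y : 𝔉.HB) : Aut (𝔉.base.obj 𝔉.BN)) ∈ P.pre (𝔉.base.obj 𝔉.BN)),
      (QuotientGroup.mk (P.proj _ ⟨_, hh⟩) : 𝔉.lDeltaModN 𝔉.BN) = x) :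
    𝔉.CycRigidityCoincide
      (𝔉.rho219OfBiTheta h1 h3 hsec hcs h8 DK T ι h59iv.2.2.choose_spec.choose
        h59iv.2.2.choose_spec.choose_spec.choose h59iv.2.2.choose_spec.choose_spec.choose_spec.1 ψ) ρ hB :=
  𝔉.cycRigidityCoincide_rho219OfBiTheta h1 h3 hsec hcs h8 DK T ι _ _ _ h59iv.2.1 P ρ hB hρ ψ hψ hcov

end ThetaFrobenioid

end Literature.AnabelianGeometry.EtaleTheta

end
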